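import Summits.QuantumFields.YangMills.Theorems.BalabanUVNodesN19RieszProductLaws
import Summits.QuantumFields.YangMills.Theorems.BalabanUVNodesN19UniformMomentSummabilityThresholdSharp

/-!
# N19 (NE7, s3 ALTERNATIVE CURRENCY) — THE LAW-SUMMABILITY THRESHOLD OF THE UNIFORM-MOMENT CURRENCY IS EXACT FOR ALL POSITIVE CLOSENESS SEQUENCES

Module 103 of the `dag-n19-e` lineage; the uniform-moment half of CURRENCY-MAP v4's open item (y).  Module 79 (p599277
`summable_lawIncrements_iff_summable_invLogRate`) proved, for an ANTITONE closeness `r > 0`: `Σ_K 1∕(1 + log⁺ r_K⁻¹) < ∞`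
IFF every sequence of probability laws on `[−1,1]` whose moments move by `≤ r_K` at step `K` UNIFORMLY IN THE ORDER
has summable bounded-Lipschitz increments.  Here the monotonicity is removed.

★★★ `exists_uniformMoments_not_summable_lawIncrements_of_pos`: for EVERY `r > 0` with `Σ_K 1∕(1 + log⁺ r_K⁻¹) = ∞`
there are probability laws `λ_K` on `[−1,1]` with `|∫x^j dλ_{K+1} − ∫x^j dλ_K| ≤ r_K` for every `j, K` and continuous
`1`-Lipschitz `1`-bounded tests with NON-summable increments; ★★★ `summable_lawIncrements_iff_summable_invLogRate_of_pos`: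
the threshold is exact for every positive `r`.

THE SEQUENCE — THE HALF-SCALE RIESZ-PRODUCT LAWS (module 101 at scale `c = ½`): the law of `½cos φ` under
`(1∕π)∏_{e∈A_K}(1 + cos(8^{e+1}φ))dφ`, `A_{K+1} = A_K △ {e(K)}`.  Toggling level `e` leaves the moments `j ≤ 6·8^e`
FIXED and moves every moment by `≤ (½)^j` (support `[−½,½]`), so ALL moments move by `≤ (½)^{6·8^e+1} =: cost(e)`;
`e(K)` is the least level with `cost(e) ≤ r_K` (`Nat.find`).  The test of level `e` is the half-scale clamped
polynomial `½·G_n(clamp(2x))`, `G_n(y) = (1−y²)T_n(y)∕(4n)`, `n = 8^{e+1}` (`1`-Lipschitz, `≤ 1∕(8n)`), paid EXACTLY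
`1∕(32n)`.  THE INVERSION is one line: if `e(K) = j+1` then `r_K < (½)^{6·8^j+1}`, so `log⁺ r_K⁻¹ ≥ (6·8^j+1)log 2` and
`(1∕1024)∕(1 + log⁺ r_K⁻¹) ≤ 1∕(32·8^{j+2})`; level `0` pays `1∕256 ≥ 1∕1024`.  Every step pays `≥ κ·rate` — no parity,
no monotonicity.

HONEST FRAMING (binding).  Elementary and [folklore] (Riesz products) over Mathlib + the lineage BY NAME (modules
78 ∕ 79 ∕ 101); TOY laws; no scheme object, no Theses import; NO consumer in the DAG today; nothing of Bałaban's
instantiated; NE7 NOT PRINTED, NOT proved; N19 NOT discharged; count-neutral.  One finite `T⁴` programme at fixed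
`ε`; nothing continuum ∕ `ℝ⁴` ∕ OS ∕ mass-gap ∕ Clay.  0 `def` ∕ 0 `sorry`.
-/

noncomputable section

open Real Finset MeasureTheory ProbabilityTheory Polynomial Polynomial.Chebyshev

namespace Summit.QuantumFields.YangMills.Theorems.BalabanUVNodesN19UniformMomentSummabilityThresholdExact

open BalabanUVNodesN19RieszProductLaws
open BalabanUVNodesN19UniformMomentSummabilityThreshold
  (invLogRate_pos invLogRate_le_one invLogRate_posLog_inv_mono summable_lawIncrements_of_uniformMoments)
open BalabanUVNodesN19UniformMomentSummabilityThresholdSharp (not_summable_invLogRate_geometric)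

/-! ## §1 The half-scale test: clamp, rescale [folklore] -/

/-- The clamp `x ↦ max(−1, min(x, 1))` is `1`-Lipschitz. [bookkeeping] -/
theorem abs_clamp_sub_clamp_le (a b : ℝ) : |max (-1) (min a 1) - max (-1) (min b 1)| ≤ |a - b| := by
  have h1 := abs_max_sub_max_le_max (-1 : ℝ) (min a 1) (-1) (min b 1)
  have h2 := abs_min_sub_min_le_max a 1 b 1
  simp only [sub_self, abs_zero] at h1 h2
  rw [max_eq_right (a := (0 : ℝ)) (abs_nonneg (min a 1 - min b 1))] at h1
  rw [max_eq_left (b := (0 : ℝ)) (abs_nonneg (a - b))] at h2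
  exact h1.trans h2

/-- The clamp lands in `[−1,1]`. [bookkeeping] -/
theorem clamp_mem_Icc (a : ℝ) : max (-1) (min a 1) ∈ Set.Icc (-1 : ℝ) 1 :=
  ⟨le_max_left _ _, max_le (by norm_num) (min_le_right _ _)⟩

/-- The clamp is the identity on `[−1,1]`. [bookkeeping] -/
theorem clamp_eq_self {a : ℝ} (ha : a ∈ Set.Icc (-1 : ℝ) 1) : max (-1) (min a 1) = a := by
  rw [min_eq_left ha.2, max_eq_right ha.1]

/-- Continuity of the clamp. [bookkeeping] -/
theorem continuous_clamp : Continuous fun a : ℝ => max (-1) (min a 1) :=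
  continuous_const.max (continuous_id.min continuous_const)

/-- ★ THE HALF-SCALE TEST of frequency `n ≥ 1`: `x ↦ ½·G_n(clamp(2x))`, `G_n(y) = (1−y²)T_n(y)∕(4n)`, is continuous,
`1`-Lipschitz and `1∕(8n)`-bounded on `[−1,1]` (module 101 `rieszTest_lipschitz_bound` + the `1`-Lipschitz clamp).
[folklore] -/
theorem halfScaleTest_lipschitz_bound {n : ℕ} (hn : 1 ≤ n) :
    (Continuous fun x : ℝ => (1 / 2 : ℝ) * ((1 - (max (-1) (min (2 * x) 1)) ^ 2) *
      (T ℝ (n : ℤ)).eval (max (-1) (min (2 * x) 1)) / (4 * (n : ℝ)))) ∧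
    (∀ x y : ℝ, x ∈ Set.Icc (-1 : ℝ) 1 → y ∈ Set.Icc (-1 : ℝ) 1 →
      |(1 / 2 : ℝ) * ((1 - (max (-1) (min (2 * x) 1)) ^ 2) * (T ℝ (n : ℤ)).eval (max (-1) (min (2 * x) 1)) / (4 * (n : ℝ))) -
        (1 / 2 : ℝ) * ((1 - (max (-1) (min (2 * y) 1)) ^ 2) * (T ℝ (n : ℤ)).eval (max (-1) (min (2 * y) 1)) / (4 * (n : ℝ)))|
        ≤ 1 * |x - y|) ∧
    ∀ x : ℝ, x ∈ Set.Icc (-1 : ℝ) 1 →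
      |(1 / 2 : ℝ) * ((1 - (max (-1) (min (2 * x) 1)) ^ 2) * (T ℝ (n : ℤ)).eval (max (-1) (min (2 * x) 1)) / (4 * (n : ℝ)))|
        ≤ 1 / (8 * (n : ℝ)) := by
  obtain ⟨hL, hB⟩ := rieszTest_lipschitz_bound hn
  have hc2 : Continuous fun x : ℝ => max (-1) (min (2 * x) 1) := continuous_clamp.comp (continuous_const.mul continuous_id)
  refine ⟨continuous_const.mul ((((continuous_const.sub (hc2.pow 2)).mul
      ((Polynomial.continuous _).comp hc2))).div_const _), fun x y _ _ => ?_, fun x _ => ?_⟩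
  · rw [← mul_sub, abs_mul, abs_of_pos (by norm_num : (0 : ℝ) < 1 / 2)]
    have h := hL _ _ (clamp_mem_Icc (2 * x)) (clamp_mem_Icc (2 * y))
    have hcl := abs_clamp_sub_clamp_le (2 * x) (2 * y)
    rw [← mul_sub, abs_mul, abs_two] at hcl
    nlinarith [abs_nonneg (x - y)]
  · rw [abs_mul, abs_of_pos (by norm_num : (0 : ℝ) < 1 / 2)]
    have h := hB _ (clamp_mem_Icc (2 * x))
    have hn0 : (0 : ℝ) < n := by exact_mod_cast hn
    rw [show 1 / (8 * (n : ℝ)) = 1 / 2 * (1 / (4 * n)) by field_simp; ring]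
    exact mul_le_mul_of_nonneg_left h (by norm_num)

/-- ★ **THE EXACT PAYMENT OF A HALF-SCALE TOGGLE.**  For the Riesz laws at scale `½`, `e ∉ A` and `n = 8^{e+1}`: the
half-scale test of frequency `n` is paid `∫g dλ_{A∪{e}} − ∫g dλ_A = 1∕(32n)` (at `x = ½cos φ` the clamp is inactive and
the test is `sin²φ·cos(nφ)∕(8n)`; module 100 (d′)). [folklore] -/
theorem integral_halfScaleTest_toggle_sub {Λ : Finset ℕ → Measure ℝ}
    (hΛ : ∀ (A : Finset ℕ) (f : ℝ → ℝ), Continuous f →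
      ∫ x, f x ∂(Λ A) = (1 / π) * ∫ φ in (0 : ℝ)..π, f ((1 / 2 : ℝ) * Real.cos φ) *
        ∏ e ∈ A, (1 + Real.cos ((8 : ℝ) ^ (e + 1) * φ)))
    {A : Finset ℕ} {e : ℕ} (he : e ∉ A) :
    ∫ x, (1 / 2 : ℝ) * ((1 - (max (-1) (min (2 * x) 1)) ^ 2) *
        (T ℝ ((8 ^ (e + 1) : ℕ) : ℤ)).eval (max (-1) (min (2 * x) 1)) / (4 * ((8 ^ (e + 1) : ℕ) : ℝ))) ∂(Λ (insert e A)) -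
      ∫ x, (1 / 2 : ℝ) * ((1 - (max (-1) (min (2 * x) 1)) ^ 2) *
        (T ℝ ((8 ^ (e + 1) : ℕ) : ℤ)).eval (max (-1) (min (2 * x) 1)) / (4 * ((8 ^ (e + 1) : ℕ) : ℝ))) ∂(Λ A) =
        1 / (32 * ((8 ^ (e + 1) : ℕ) : ℝ)) := by
  have hn1 : 1 ≤ 8 ^ (e + 1) := Nat.one_le_pow _ _ (by norm_num)
  obtain ⟨hcont, -, -⟩ := halfScaleTest_lipschitz_bound (n := 8 ^ (e + 1)) hn1
  rw [integral_toggle_sub hΛ he hcont]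
  have hν : (((8 ^ (e + 1) : ℕ) : ℤ) : ℝ) = (8 : ℝ) ^ (e + 1) := by push_cast; ring
  have hν' : ((8 ^ (e + 1) : ℕ) : ℝ) = (8 : ℝ) ^ (e + 1) := by push_cast; ring
  have hcl : ∀ φ : ℝ, max (-1) (min (2 * ((1 / 2 : ℝ) * Real.cos φ)) 1) = Real.cos φ := fun φ => by
    rw [show 2 * ((1 / 2 : ℝ) * Real.cos φ) = Real.cos φ by ring]
    exact clamp_eq_self ⟨Real.neg_one_le_cos φ, Real.cos_le_one φ⟩
  have e1 : (fun φ : ℝ => (1 / 2 : ℝ) * ((1 - (max (-1) (min (2 * ((1 / 2 : ℝ) * Real.cos φ)) 1)) ^ 2) *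
      (T ℝ ((8 ^ (e + 1) : ℕ) : ℤ)).eval (max (-1) (min (2 * ((1 / 2 : ℝ) * Real.cos φ)) 1)) /
        (4 * ((8 ^ (e + 1) : ℕ) : ℝ))) * Real.cos ((8 : ℝ) ^ (e + 1) * φ) *
        ∏ k ∈ A, (1 + Real.cos ((8 : ℝ) ^ (k + 1) * φ))) = fun φ => (1 / (8 * (8 : ℝ) ^ (e + 1))) *
      (Real.sin φ ^ 2 * Real.cos ((8 : ℝ) ^ (e + 1) * φ) ^ 2 * ∏ k ∈ A, (1 + Real.cos ((8 : ℝ) ^ (k + 1) * φ))) := by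
    funext φ
    rw [hcl, T_real_cos, hν, hν', Real.sin_sq]
    ring
  rw [e1, intervalIntegral.integral_const_mul,
    BalabanUVNodesN19OctalLacunaryDissociation.integral_sin_sq_mul_cosOct_sq_mul_rieszDensity he, hν']
  field_simp
  ring

/-! ## §2 The half-scale Riesz-product sequence at the level of the budget [folklore] -/

/-- ★★★ **THE LOWER HALF OF THE THRESHOLD (uniform-moment currency), FOR EVERY POSITIVE CLOSENESS.**  For every `r > 0`
(NO monotonicity) whose rates `1∕(1 + log⁺ r_K⁻¹)` are NOT summable there are probability laws `λ_K` on `[−1,1]` with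
`|∫x^j dλ_{K+1} − ∫x^j dλ_K| ≤ r_K` for EVERY `j` and continuous tests `g_K`, `1`-Lipschitz and `1`-bounded on `[−1,1]`,
whose increments `|∫g_K dλ_{K+1} − ∫g_K dλ_K|` are NOT summable (the half-scale Riesz toggles, header). [folklore] -/
theorem exists_uniformMoments_not_summable_lawIncrements_of_pos {r : ℕ → ℝ} (hr : ∀ K, 0 < r K)
    (hS : ¬ Summable fun K => 1 / (1 + Real.posLog (r K)⁻¹)) :
    ∃ Λ : ℕ → Measure ℝ, (∀ K, IsProbabilityMeasure (Λ K)) ∧ (∀ K, Λ K (Set.Icc (-1 : ℝ) 1)ᶜ = 0) ∧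
      (∀ K j : ℕ, |∫ x, x ^ j ∂Λ (K + 1) - ∫ x, x ^ j ∂Λ K| ≤ r K) ∧
      ∃ g : ℕ → ℝ → ℝ, (∀ K, Continuous (g K)) ∧
        (∀ (K : ℕ) (x y : ℝ), x ∈ Set.Icc (-1 : ℝ) 1 → y ∈ Set.Icc (-1 : ℝ) 1 → |g K x - g K y| ≤ 1 * |x - y|) ∧
        (∀ (K : ℕ) (x : ℝ), x ∈ Set.Icc (-1 : ℝ) 1 → |g K x| ≤ 1) ∧
        ¬ Summable (fun K => |∫ x, g K x ∂Λ (K + 1) - ∫ x, g K x ∂Λ K|) := by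
  classical
  -- the Riesz-product laws at scale `½`
  obtain ⟨Λ, hP, hsupp, -, hform⟩ := exists_rieszLaws (c := (1 / 2 : ℝ)) (by rw [abs_of_pos (by norm_num)]; norm_num)
  haveI : ∀ A, IsProbabilityMeasure (Λ A) := hP
  have hhalf : |(1 / 2 : ℝ)| = 1 / 2 := abs_of_pos (by norm_num)
  -- the uniform-moment price of a level and its decay
  set cost : ℕ → ℝ := fun i => (1 / 2 : ℝ) ^ (6 * 8 ^ i + 1) with hcost
  have hcost_small : ∀ x : ℝ, 0 < x → ∃ i : ℕ, cost i ≤ x := by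
    intro x hx
    obtain ⟨i, hi⟩ := exists_pow_lt_of_lt_one hx (by norm_num : (1 / 2 : ℝ) < 1)
    refine ⟨i, le_trans ?_ hi.le⟩
    have : i ≤ 6 * 8 ^ i + 1 := by have : i < 8 ^ i := Nat.lt_pow_self (by norm_num); omega
    exact pow_le_pow_of_le_one (by norm_num) (by norm_num) this
  -- THE LEVEL OF THE BUDGET
  have hex : ∀ K : ℕ, ∃ i : ℕ, cost i ≤ r K := fun K => hcost_small _ (hr K)
  let ix : ℕ → ℕ := fun K => Nat.find (hex K)
  have hix_spec : ∀ K, cost (ix K) ≤ r K := fun K => Nat.find_spec (hex K)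
  have hix_min : ∀ K j, j < ix K → r K < cost j := fun K j hj => not_le.1 (Nat.find_min (hex K) hj)
  -- the set of active levels
  obtain ⟨A, -, hA⟩ : ∃ A : ℕ → Finset ℕ, A 0 = ∅ ∧
      ∀ K, A (K + 1) = if ix K ∈ A K then (A K).erase (ix K) else insert (ix K) (A K) :=
    ⟨fun K => Nat.rec (motive := fun _ => Finset ℕ) ∅
      (fun K S => if ix K ∈ S then S.erase (ix K) else insert (ix K) S) K, rfl, fun K => rfl⟩
  have htog : ∀ K, ∃ B : Finset ℕ, ix K ∉ B ∧
      ((A (K + 1) = insert (ix K) B ∧ A K = B) ∨ (A (K + 1) = B ∧ A K = insert (ix K) B)) := by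
    intro K
    by_cases h : ix K ∈ A K
    · refine ⟨(A K).erase (ix K), Finset.notMem_erase _ _, Or.inr ⟨by rw [hA K, if_pos h], ?_⟩⟩
      exact (Finset.insert_erase h).symm
    · exact ⟨A K, h, Or.inl ⟨by rw [hA K, if_neg h], rfl⟩⟩
  -- the tests
  set g : ℕ → ℝ → ℝ := fun K x => (1 / 2 : ℝ) * ((1 - (max (-1) (min (2 * x) 1)) ^ 2) *
    (T ℝ ((8 ^ (ix K + 1) : ℕ) : ℤ)).eval (max (-1) (min (2 * x) 1)) / (4 * ((8 ^ (ix K + 1) : ℕ) : ℝ))) with hg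
  have hn1 : ∀ K, 1 ≤ 8 ^ (ix K + 1) := fun K => Nat.one_le_pow _ _ (by norm_num)
  have hpay : ∀ K, |∫ x, g K x ∂Λ (A (K + 1)) - ∫ x, g K x ∂Λ (A K)| = 1 / (32 * ((8 ^ (ix K + 1) : ℕ) : ℝ)) := by
    intro K
    obtain ⟨B, hB, h⟩ := htog K
    have key := integral_halfScaleTest_toggle_sub hform hB
    rcases h with ⟨h1, h2⟩ | ⟨h1, h2⟩
    · rw [h1, h2]; simp only [hg]; rw [key]; exact abs_of_pos (by positivity)
    · rw [h1, h2, abs_sub_comm]; simp only [hg]; rw [key]; exact abs_of_pos (by positivity)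
  -- the uniform moment price of step `K` is at most `cost (ix K) ≤ r K`
  have hmom : ∀ K j : ℕ, |∫ x, x ^ j ∂Λ (A (K + 1)) - ∫ x, x ^ j ∂Λ (A K)| ≤ cost (ix K) := by
    intro K j
    obtain ⟨B, hB, h⟩ := htog K
    have key : |∫ x, x ^ j ∂Λ (insert (ix K) B) - ∫ x, x ^ j ∂Λ B| ≤ cost (ix K) := by
      rcases le_or_gt j (6 * 8 ^ ix K) with hj | hj
      · rw [moment_toggle_eq hform hB hj, sub_self, abs_zero]; positivity
      · refine (abs_moment_toggle_sub_le hform hB j).trans ?_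
        rw [hhalf]
        exact pow_le_pow_of_le_one (by norm_num) (by norm_num) (by omega)
    rcases h with ⟨h1, h2⟩ | ⟨h1, h2⟩
    · rw [h1, h2]; exact key
    · rw [h1, h2, abs_sub_comm]; exact key
  refine ⟨fun K => Λ (A K), fun K => hP _, fun K => hsupp _, fun K j => (hmom K j).trans (hix_spec K), g,
    fun K => (halfScaleTest_lipschitz_bound (hn1 K)).1,
    fun K x y hx hy => (halfScaleTest_lipschitz_bound (hn1 K)).2.1 x y hx hy,
    fun K x hx => ((halfScaleTest_lipschitz_bound (hn1 K)).2.2 x hx).trans ?_, fun hSum => ?_⟩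
  · -- `1∕(8n) ≤ 1`
    rw [div_le_one (by positivity)]
    have : (1 : ℝ) ≤ ((8 ^ (ix K + 1) : ℕ) : ℝ) := by exact_mod_cast hn1 K
    linarith
  · -- NOT SUMMABLE: every step pays at least `κ·rate`, `κ = 1∕1024`
    set ρ : ℕ → ℝ := fun K => 1 / (1 + Real.posLog (r K)⁻¹) with hρdef
    have hρ0 : ∀ K, 0 ≤ ρ K := fun K => (invLogRate_pos _).le
    have hρ1 : ∀ K, ρ K ≤ 1 := fun K => invLogRate_le_one _
    have hkey : ∀ K : ℕ, (1 / 1024 : ℝ) * ρ K ≤ 1 / (32 * ((8 ^ (ix K + 1) : ℕ) : ℝ)) := by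
      intro K
      have hcast : ((8 ^ (ix K + 1) : ℕ) : ℝ) = (8 : ℝ) ^ (ix K + 1) := by push_cast; ring
      rw [hcast]
      rcases Nat.eq_zero_or_pos (ix K) with h0 | hpos
      · rw [h0]
        have h1 : (1 / 1024 : ℝ) * ρ K ≤ 1 / 1024 := mul_le_of_le_one_right (by norm_num) (hρ1 _)
        norm_num at h1 ⊢
        linarith
      · obtain ⟨j, hj⟩ : ∃ j, ix K = j + 1 := ⟨ix K - 1, by omega⟩
        have hlt := hix_min K j (by omega)
        rw [hj]
        simp only [hcost] at hlt
        -- `r_K < (½)^{M}`, `M = 6·8^j + 1`, so `log⁺ r_K⁻¹ ≥ M·log 2 ≥ M∕2`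
        set M : ℕ := 6 * 8 ^ j + 1 with hM
        have hrpos := hr K
        have hinv : (2 : ℝ) ^ M ≤ (r K)⁻¹ := by
          rw [show (2 : ℝ) ^ M = ((1 / 2 : ℝ) ^ M)⁻¹ by rw [one_div, inv_pow, inv_inv]]
          exact inv_anti₀ hrpos hlt.le
        have hlog : (M : ℝ) * Real.log 2 ≤ Real.posLog (r K)⁻¹ := by
          have h1 : Real.log ((2 : ℝ) ^ M) ≤ Real.log (r K)⁻¹ := Real.log_le_log (by positivity) hinv
          rw [Real.log_pow] at h1
          exact h1.trans (by rw [Real.posLog_apply]; exact le_max_right _ _)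
        have hl2 : (1 / 2 : ℝ) ≤ Real.log 2 := by linarith [Real.log_two_gt_d9]
        have hMr : (M : ℝ) = 6 * 8 ^ j + 1 := by rw [hM]; push_cast; ring
        have hP0 : (0 : ℝ) < 8 ^ j := by positivity
        have hpl := Real.posLog_nonneg (x := (r K)⁻¹)
        have h5 : (M : ℝ) * (1 / 2) ≤ Real.posLog (r K)⁻¹ :=
          (mul_le_mul_of_nonneg_left hl2 (by positivity)).trans hlog
        rw [hρdef]
        rw [show (1 / 1024 : ℝ) * (1 / (1 + Real.posLog (r K)⁻¹)) = 1 / (1024 * (1 + Real.posLog (r K)⁻¹)) by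
          field_simp]
        rw [show (8 : ℝ) ^ (j + 1 + 1) = 64 * 8 ^ j by ring]
        exact one_div_le_one_div_of_le (by positivity) (by nlinarith)
    simp_rw [hpay] at hSum
    have hκr : Summable (fun K => (1 / 1024 : ℝ) * ρ K) :=
      Summable.of_nonneg_of_le (fun K => mul_nonneg (by norm_num) (hρ0 K)) hkey hSum
    exact hS ((summable_mul_left_iff (by norm_num : (1 / 1024 : ℝ) ≠ 0)).1 hκr)

/-! ## §3 The exact threshold for every positive closeness [folklore] -/

/-- ★★★ **THE EXACT LAW-SUMMABILITY THRESHOLD OF THE UNIFORM-MOMENT CURRENCY — ALL POSITIVE CLOSENESS SEQUENCES.**  For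
ANY `r > 0`: `Σ_K 1∕(1 + log⁺ r_K⁻¹) < ∞` IF AND ONLY IF every sequence of probability laws `λ_K` on `[−1,1]` with
`|∫x^j dλ_{K+1} − ∫x^j dλ_K| ≤ r_K` for every `j` has summable increments `|∫g_K dλ_{K+1} − ∫g_K dλ_K|` along every
sequence of continuous tests `g_K`, `1`-Lipschitz and `1`-bounded on `[−1,1]` (⇒ module 78
`summable_lawIncrements_of_uniformMoments`; ⇐ §2; module 79's iff is the antitone case). [folklore] -/
theorem summable_lawIncrements_iff_summable_invLogRate_of_pos {r : ℕ → ℝ} (hr : ∀ K, 0 < r K) :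
    (Summable fun K => 1 / (1 + Real.posLog (r K)⁻¹)) ↔
      ∀ Λ : ℕ → Measure ℝ, (∀ K, IsProbabilityMeasure (Λ K)) → (∀ K, Λ K (Set.Icc (-1 : ℝ) 1)ᶜ = 0) →
        (∀ K j : ℕ, |∫ x, x ^ j ∂Λ (K + 1) - ∫ x, x ^ j ∂Λ K| ≤ r K) →
        ∀ g : ℕ → ℝ → ℝ, (∀ K, Continuous (g K)) →
          (∀ (K : ℕ) (x y : ℝ), x ∈ Set.Icc (-1 : ℝ) 1 → y ∈ Set.Icc (-1 : ℝ) 1 → |g K x - g K y| ≤ 1 * |x - y|) →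
          (∀ (K : ℕ) (x : ℝ), x ∈ Set.Icc (-1 : ℝ) 1 → |g K x| ≤ 1) →
          Summable fun K => |∫ x, g K x ∂Λ (K + 1) - ∫ x, g K x ∂Λ K| := by
  refine ⟨fun hS Λ hP hc hM g hg hL hB => ?_, fun h => ?_⟩
  · haveI := hP
    exact summable_lawIncrements_of_uniformMoments hc hM hS hg zero_le_one hL hB
  · by_contra hS
    obtain ⟨Λ, hP, hc, hM, g, hgc, hL, hB, hns⟩ := exists_uniformMoments_not_summable_lawIncrements_of_pos hr hS
    exact hns (h Λ hP hc hM g hgc hL hB)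

/-- ★★ **UNIFORM MOMENT MATCHING AT ANY CLOSENESS BOUNDED BELOW GEOMETRICALLY — MONOTONE OR NOT — ADMITS LAWS WITH
NON-SUMMABLE INCREMENTS**: `Cθ^K ≤ r_K` (`C, θ > 0`) ⇒ laws `λ_K` on `[−1,1]` with `|∫x^j dλ_{K+1} − ∫x^j dλ_K| ≤ r_K`
for every `j` and continuous `1`-Lipschitz `1`-bounded tests with `Σ_K |∫g_K dλ_{K+1} − ∫g_K dλ_K| = ∞` (module 79's
instance without its monotonicity; the rates dominate those of `Cθ^K`, which are not summable). [folklore] -/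
theorem exists_uniformMoments_not_summable_lawIncrements_of_geometric_le {C θ : ℝ} {r : ℕ → ℝ} (hC : 0 < C)
    (hθ : 0 < θ) (hle : ∀ K : ℕ, C * θ ^ K ≤ r K) :
    ∃ Λ : ℕ → Measure ℝ, (∀ K, IsProbabilityMeasure (Λ K)) ∧ (∀ K, Λ K (Set.Icc (-1 : ℝ) 1)ᶜ = 0) ∧
      (∀ K j : ℕ, |∫ x, x ^ j ∂Λ (K + 1) - ∫ x, x ^ j ∂Λ K| ≤ r K) ∧
      ∃ g : ℕ → ℝ → ℝ, (∀ K, Continuous (g K)) ∧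
        (∀ (K : ℕ) (x y : ℝ), x ∈ Set.Icc (-1 : ℝ) 1 → y ∈ Set.Icc (-1 : ℝ) 1 → |g K x - g K y| ≤ 1 * |x - y|) ∧
        (∀ (K : ℕ) (x : ℝ), x ∈ Set.Icc (-1 : ℝ) 1 → |g K x| ≤ 1) ∧
        ¬ Summable (fun K => |∫ x, g K x ∂Λ (K + 1) - ∫ x, g K x ∂Λ K|) :=
  exists_uniformMoments_not_summable_lawIncrements_of_pos (fun K => lt_of_lt_of_le (by positivity) (hle K)) fun hS =>
    not_summable_invLogRate_geometric C θ
      (Summable.of_nonneg_of_le (fun K => (invLogRate_pos _).le)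
        (fun K => invLogRate_posLog_inv_mono (by positivity : 0 < C * θ ^ K) (hle K)) hS)

end Summit.QuantumFields.YangMills.Theorems.BalabanUVNodesN19UniformMomentSummabilityThresholdExact

end
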